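import Summits.BirchSwinnertonDyer.BirchSwinnertonDyer.Theorems.UniversalToricDescentSigmaLocalStabilizer
import Summits.BirchSwinnertonDyer.BirchSwinnertonDyer.Theorems.UniversalToricDescentQuotientBoundByCoordinates
import Literature.NumberTheory.EllipticCurves.FineSelmerTorsionCoefficientsFiniteProofs
import HarnessLib

/-!
# Tuple reduction at a LAYER `U ⊇ ker κ`: the away condition at `v` for ALL conjugates is the vanishing of `p^c` coordinates
# `res_{U ∩ D_v}(conj_{γ^i} x)`, which lie in `ker(H¹(U ∩ D_v, M) → H¹(ker κ ∩ D_v, M))` when `res_{ker κ} x` is away-trivial;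
# hence `#(𝓓/𝓕) ≤ t^{p^c}` for the image count (c) of the relaxed count road
# (crux ♭T≤ stmt-BirchSwinnertonDyer-23042, line `sigmacongruence`, stub R1 `stub_relaxedImageCount`, step (c) IMAGE COUNT — tuple end)

Width prover `bsd-wall-utd-p1-w2` g3 under lead `bsd-wall-utd-p1` g18 (`--supports stmt-BirchSwinnertonDyer-23042`, helper).
THEOREMS ONLY (no definition, no named fact, no `sorry`). BSD is not proved by any of this.

Setting: `K` a number field, `κ : Γ_K ↠ ℤ_p` a `ℤ_p`-extension (`H = ker κ`, topological generator `γ`, `κ γ = 1`), `U` a NORMAL subgroup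
of `Γ_K` containing `H` (on the route: `U = Γ_m = κ.layerSubgroup m`), `M` a discrete `Γ_K`-module (`A = E[p^∞]` or `A[p^k]`), `v` a finite
place with decomposition group `D_v = decomp v` such that `κ(D_v) ⊇ p^c ℤ_p` (`hc`, from the exact index
`UniversalToricDescentSigmaLocalStabilizer.exists_pow_and_forall_dvd_of_not_le`). The away condition at `v` at level `U` is
`awayKer U M v = ker(res : H¹(U, M) → H¹(U ∩ D_v, M))` (`GreenbergSelmer.awayKer`); "for all conjugates" quantifies `conj_σ`, `σ ∈ Γ_K`.
The lead's step (c) (memo `Cruxes/DefectTransportModThreePT/Lines/sigmacongruence-relaxed-count-road.md` §2 (c)):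
«`H¹_𝓓/H¹_𝓕 ↪ ∏_{i<p^c} ker(H¹(Γ_n ∩ D_v, A) → H¹(kerD, A))` (`x ↦ (res conj_{γ^i} x̃)_i`; `x ∈ H¹_𝓕` iff all these restrictions
vanish — the classical condition at `v` for every conjugate), and `#ker ≤ t_v` UNIFORMLY in `n`». This file supplies the group-cohomology half:

* §2 `forall_conjH1_mem_awayKer_iff_forall_lt` — **`(∀ σ, conj_σ x ∈ awayKer U M v) ↔ (∀ i < p^c, conj_{γ^i} x ∈ awayKer U M v)`** for
  `x ∈ H¹(U, M)`: `σ = d · γ^i · h` with `d ∈ D_v`, `i < p^c`, `h ∈ H ≤ U` (`PadicInt.appr`, as in `…SigmaLocalStabilizer.exists_decomp_mul_pow_mul_mem_ker`); `conj_h = id` on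
  `H¹(U, M)` (inner, `conjH1_of_mem`), and `conj_d` preserves vanishing on `U ∩ D_v` (`resOfLe_conjH1_eq_zero_of_mem`).
* §1 `resOfLe_conjH1_mem_ker_of_forall_mem_awayKer` — if `res_{H} x` is away-trivial at `v` for all conjugates (`H ≤ U` both normal),
  then every coordinate `res_{U ∩ D_v}(conj_τ x)` lies in `ker(res : H¹(U ∩ D_v, M) → H¹(H ∩ D_v, M))` (`res ∘ conj = conj ∘ res`,
  transitivity of `res`).
* §3 **`natCard_quotient_addSubgroupOf_le_pow_of_awayKer`** — for an additive `Ψ : X → H¹(U, M)` (the lead's transport `Φ_m`) and subgroups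
  `F, D ≤ X` with (i) `res_H (Ψ x)` away-trivial at `v` for all conjugates whenever `x ∈ D`, (ii) `x ∈ D` and `conj_σ (Ψ x) ∈ awayKer U M v`
  for all `σ` imply `x ∈ F`: **`#(D / F) ≤ t^{p^c}`** where `t` bounds `#ker(H¹(U ∩ D_v, M) → H¹(H ∩ D_v, M))`
  (`…QuotientBoundByCoordinates.natCard_quotient_addSubgroupOf_le_pow` with the tuple map `x ↦ (res_{U∩D_v} conj_{γ^i} Ψ x)_{i<p^c}`).
  The bound `t` is the lead's / width g2's uniform kernel index (`…TowerDescentIndex`, `…LayerDescentKernelIndex`,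
  `…RelaxedLocalLevelShift.natCard_ker_torsionToPrimary_kerD_le`).

References: [GreenbergVatsal2000] §2 pp. 24–25; [GreenbergLNM1716] §1 (p. 60), §3 Lemma 3.3 (p. 87); [SerreGaloisCohomology1997] I §2.5,
I §5.1; [SerreLocalFields1979] VII §5 Prop. 3; [Washington1997] §13.1.
-/

-- `…BirchSwinnertonDyer.BirchSwinnertonDyer…` is the problem's mandated namespace (D-0017 nested layout)
set_option linter.dupNamespace false
set_option autoImplicit false

noncomputable section
open scoped Classical
open Field NumberField IsDedekindDomain Function
open Literature.NumberTheory.EllipticCurves Literature.NumberTheory.EllipticCurves.GreenbergSelmer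
open Literature.NumberTheory.GaloisRepresentations

namespace Summit.BirchSwinnertonDyer.BirchSwinnertonDyer.Theorems.UniversalToricDescentLayerTupleReduction

open Summit.BirchSwinnertonDyer.BirchSwinnertonDyer.Theorems.UniversalToricDescentQuotientBoundByCoordinates

variable {K : Type} [Field K] [NumberField K] {p : ℕ} [Fact p.Prime] (κ : ZpExtension K p)
  {M : Type} [AddCommGroup M] [DistribMulAction (absoluteGaloisGroup K) M] [TopologicalSpace M] [DiscreteTopology M]
  (v : HeightOneSpectrum (𝓞 K))

/-! ## §1 The coordinates lie in the descent kernel -/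

/-- **Coordinates in the kernel**: for normal subgroups `H ≤ U` of `Γ_K` and `x ∈ H¹(U, M)` whose restriction to `H` is away-trivial at `v`
for all conjugates (`conj_σ (res_H x) ∈ awayKer H M v` for all `σ`), every `res_{U ∩ D_v}(conj_τ x)` restricts to `0` on `H ∩ D_v`, i.e.
lies in `ker(res : H¹(U ∩ D_v, M) → H¹(H ∩ D_v, M))` (`res ∘ conj_τ = conj_τ ∘ res`, `res ∘ res = res`).
[cite: SerreGaloisCohomology1997, I §2.5] [cite: GreenbergLNM1716, §3 Lemma 3.3 (p. 87)] -/
theorem resOfLe_conjH1_mem_ker_of_forall_mem_awayKer {H U : Subgroup (absoluteGaloisGroup K)} [H.Normal] [U.Normal]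
    (hHU : H ≤ U) (x : subgroupH1 U M)
    (hx : ∀ σ : absoluteGaloisGroup K, conjH1 H M σ (resOfLe M hHU x) ∈ awayKer H M v) (τ : absoluteGaloisGroup K) :
    resOfLe M (inf_le_left : U ⊓ decomp v ≤ U) (conjH1 U M τ x) ∈
      (resOfLe M (inf_le_inf_right (decomp (K := K) v) hHU : H ⊓ decomp v ≤ U ⊓ decomp v)).ker := by
  rw [AddMonoidHom.mem_ker, ← AddMonoidHom.comp_apply, resOfLe_comp_holds]
  have h := hx τ
  rw [awayKer, AddMonoidHom.mem_ker] at h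
  have hc : conjH1 H M τ (resOfLe M hHU x) = resOfLe M hHU (conjH1 U M τ x) := by
    have e := congrArg (fun f ↦ f x) (resOfLe_comp_conjH1_holds (M := M) hHU τ)
    simp only [AddMonoidHom.coe_comp, Function.comp_apply] at e
    exact e.symm
  rw [hc, ← AddMonoidHom.comp_apply, resOfLe_comp_holds] at h
  exact h

/-! ## §2 Reduction of "all conjugates" to the `p^c` representatives `γ^i` -/

/-- **`(∀ σ, conj_σ x ∈ awayKer U M v) ↔ (∀ i < p^c, conj_{γ^i} x ∈ awayKer U M v)`** for a class `x ∈ H¹(U, M)`, `U ⊇ ker κ` normal, at a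
place `v` with `κ(D_v) ⊇ p^c ℤ_p`: every `σ` is `d · γ^i · h` (`d ∈ D_v`, `i < p^c`, `h ∈ ker κ`); `conj_h` is the identity on `H¹(U, M)`
(`h ∈ U`), and `conj_d`, `d ∈ D_v`, preserves the classes dying on `U ∩ D_v`. [cite: GreenbergVatsal2000, §2 p. 24]
[cite: SerreLocalFields1979, VII §5 Prop. 3] [cite: SerreGaloisCohomology1997, I §2.5] -/
theorem forall_conjH1_mem_awayKer_iff_forall_lt (U : Subgroup (absoluteGaloisGroup K)) [U.Normal]
    (hHU : κ.kerSubgroup ≤ U) {γ : absoluteGaloisGroup K} (hγ : κ.IsTopGenerator γ) {c : ℕ}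
    (hc : ∀ z : ℤ_[p], ∃ d : decomp (K := K) v, (κ (d : absoluteGaloisGroup K)).toAdd = (p : ℤ_[p]) ^ c * z)
    (x : subgroupH1 U M) :
    (∀ σ : absoluteGaloisGroup K, conjH1 U M σ x ∈ awayKer U M v) ↔
      ∀ i : ℕ, i < p ^ c → conjH1 U M (γ ^ i) x ∈ awayKer U M v := by
  refine ⟨fun h i _ ↦ h _, fun h σ ↦ ?_⟩
  -- `σ = d · γ^i · g`, `i < p^c` (adapted from `…StubTwinSignatureTorsion.exists_decomp_mul_pow_lt_mul_mem_ker`, inlined to keep this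
  -- file off the theses cone): `i` is the residue `PadicInt.appr` of `κ σ` modulo `p^c`
  have hdec : ∃ (d : decomp (K := K) v) (i : ℕ) (g : absoluteGaloisGroup K), i < p ^ c ∧ g ∈ κ.kerSubgroup ∧
      σ = d * γ ^ i * g := by
    obtain ⟨z, hz⟩ := Ideal.mem_span_singleton.mp (PadicInt.appr_spec c (κ σ).toAdd)
    obtain ⟨d, hd⟩ := hc z
    refine ⟨d, (κ σ).toAdd.appr c, ((d : absoluteGaloisGroup K) * γ ^ (κ σ).toAdd.appr c)⁻¹ * σ, PadicInt.appr_lt _ c, ?_, ?_⟩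
    · rw [ZpExtension.mem_kerSubgroup, map_mul, map_inv, map_mul, map_pow,
        show κ γ = Multiplicative.ofAdd 1 from hγ, ← ofAdd_nsmul]
      apply Multiplicative.toAdd.injective
      rw [toAdd_mul, toAdd_inv, toAdd_mul, toAdd_ofAdd, toAdd_one, hd, nsmul_eq_mul, mul_one]
      linear_combination hz
    · rw [mul_inv_cancel_left]
  obtain ⟨d, i, g, hi, hg, rfl⟩ := hdec
  rw [conjH1_mul_holds U M ((d : absoluteGaloisGroup K) * γ ^ i) g, AddMonoidHom.comp_apply,
    Literature.NumberTheory.EllipticCurves.conjH1_of_mem_holds U M (hHU hg), AddMonoidHom.id_apply,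
    conjH1_mul_holds U M (d : absoluteGaloisGroup K) (γ ^ i), AddMonoidHom.comp_apply, awayKer, AddMonoidHom.mem_ker]
  have h0 : resOfLe M (inf_le_left : U ⊓ decomp v ≤ U) (conjH1 U M (γ ^ i) x) = 0 := by
    have h' := h i hi
    rwa [awayKer, AddMonoidHom.mem_ker] at h'
  exact FineSelmerCoefficientMap.resOfLe_conjH1_eq_zero_of_mem U (decomp v) d.2 h0

/-! ## §3 The index bound `#(𝓓/𝓕) ≤ t^{p^c}` -/

/-- **Image count, tuple end (step (c))**: `U ⊇ H = ker κ` normal, `γ` a topological generator, `κ(D_v) ⊇ p^c ℤ_p`, and `t` a bound for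
`#ker(res : H¹(U ∩ D_v, M) → H¹(H ∩ D_v, M))`. For an additive `Ψ : X → H¹(U, M)` and subgroups `D, F ≤ X` such that
(i) for `x ∈ D`, `res_H (Ψ x)` is away-trivial at `v` for all conjugates, and (ii) `x ∈ D` with `conj_σ (Ψ x) ∈ awayKer U M v` for ALL `σ`
forces `x ∈ F`: **`D/(F ∩ D)` is finite of order `≤ t^{p^c}`** — via the tuple map `x ↦ (res_{U ∩ D_v} conj_{γ^i} (Ψ x))_{i < p^c}`, whose
coordinates lie in the kernel (§1) and whose zeros lie in `F` (§2 + (ii)). On the route: `X = H¹(K_m, E[p^k])`, `Ψ = Φ_m`, `D = H¹_𝓓`,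
`F = H¹_𝓕 = KO_m(T∪∞)` (Kummer at the places over `v` ⟺ classical ⟺ away at level `Γ_m`), `t = t_v`.
[cite: GreenbergVatsal2000, §2 pp. 24–25] [cite: GreenbergLNM1716, §3 Lemma 3.3 (p. 87)] [cite: Washington1997, §13.1] -/
theorem natCard_quotient_addSubgroupOf_le_pow_of_awayKer (U : Subgroup (absoluteGaloisGroup K)) [U.Normal]
    (hHU : κ.kerSubgroup ≤ U) {γ : absoluteGaloisGroup K} (hγ : κ.IsTopGenerator γ) {c : ℕ}
    (hc : ∀ z : ℤ_[p], ∃ d : decomp (K := K) v, (κ (d : absoluteGaloisGroup K)).toAdd = (p : ℤ_[p]) ^ c * z)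
    {t : ℕ} [Finite (resOfLe M (inf_le_inf_right (decomp (K := K) v) hHU : κ.kerSubgroup ⊓ decomp v ≤ U ⊓ decomp v)).ker]
    (ht : Nat.card (resOfLe M (inf_le_inf_right (decomp (K := K) v) hHU : κ.kerSubgroup ⊓ decomp v ≤ U ⊓ decomp v)).ker ≤ t)
    {X : Type*} [AddCommGroup X] (Ψ : X →+ subgroupH1 U M) {D F : AddSubgroup X}
    (hD : ∀ x ∈ D, ∀ σ : absoluteGaloisGroup K,
      conjH1 κ.kerSubgroup M σ (resOfLe M hHU (Ψ x)) ∈ awayKer κ.kerSubgroup M v)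
    (hF : ∀ x ∈ D, (∀ σ : absoluteGaloisGroup K, conjH1 U M σ (Ψ x) ∈ awayKer U M v) → x ∈ F) :
    Finite (D ⧸ F.addSubgroupOf D) ∧ Nat.card (D ⧸ F.addSubgroupOf D) ≤ t ^ (p ^ c) := by
  let ρ : D →+ (Fin (p ^ c) → subgroupH1 (U ⊓ decomp v) M) :=
    (AddMonoidHom.pi fun i : Fin (p ^ c) ↦
        (resOfLe M (inf_le_left : U ⊓ decomp v ≤ U)).comp (conjH1 U M (γ ^ (i : ℕ)))).comp (Ψ.comp D.subtype)
  have hρ : ∀ (x : D) (i : Fin (p ^ c)),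
      ρ x i = resOfLe M (inf_le_left : U ⊓ decomp v ≤ U) (conjH1 U M (γ ^ (i : ℕ)) (Ψ x)) := fun _ _ ↦ rfl
  refine natCard_quotient_addSubgroupOf_le_pow ρ
    (fun _ ↦ (resOfLe M (inf_le_inf_right (decomp (K := K) v) hHU : κ.kerSubgroup ⊓ decomp v ≤ U ⊓ decomp v)).ker)
    (fun x i ↦ ?_) (fun _ ↦ ht) fun x hx0 ↦ ?_
  · rw [hρ]
    exact resOfLe_conjH1_mem_ker_of_forall_mem_awayKer v hHU (Ψ x) (hD x x.2) _
  · refine hF x x.2 ((forall_conjH1_mem_awayKer_iff_forall_lt κ v U hHU hγ hc (Ψ x)).mpr fun i hi ↦ ?_)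
    have h := congrFun hx0 ⟨i, hi⟩
    rw [hρ, Pi.zero_apply] at h
    rw [awayKer, AddMonoidHom.mem_ker]
    exact h

end Summit.BirchSwinnertonDyer.BirchSwinnertonDyer.Theorems.UniversalToricDescentLayerTupleReduction

end
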